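import Summits.Ventures.QEC.Census.FoldScanPT
import Summits.Ventures.QEC.Census.FoldFiber2
import HarnessLib

/-!
# Fold enumeration — the table-assisted enumerator: fibre completeness and node-check soundness

Continuation of `Census/FoldScanPT.lean`: `mem_fiberPT_of_solution`, `Geo.fiberPT_complete`, `Geo.goodFib_of_allPT`,
`nodeCheckPT_sound`, `nodeCheckPT_of_nodeCheckModPT` — the twins of the `fiber` theorems for `fiberPT`.
-/

namespace Summit.Ventures.QEC.Census.Fold

open Summit.Ventures.QEC.Census

/-! ## The table-assisted fibre enumerator -/
/-- If `fiberPT` succeeds, the pivot structure verified. -/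
theorem pivOK_of_fiberPT (G : Geo) (M Mp : ℕ → ℕ) (W b : ℕ) (up : Bool) (P : List ℕ) {out : List (List ℕ)}
    (hout : fiberPT G M Mp W b up P = some out) : pivOK (P.map M) (gaussPiv (P.map M)) = true := by
  unfold fiberPT at hout
  simp only at hout
  split at hout
  · split at hout
    · assumption
    · simp at hout
  · split at hout
    · rename_i h; unfold fiberPTchk at h; rw [Bool.and_eq_true, Bool.and_eq_true] at h; exact h.1.1
    · simp at hout
/-- **combinatorial completeness of `fiberPT`** (cf. `mem_fiber_of_solution`). -/
theorem mem_fiberPT_of_solution (G : Geo) (M Mp : ℕ → ℕ) (W b : ℕ) (up : Bool) (P : List ℕ) {out : List (List ℕ)}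
    (hout : fiberPT G M Mp W b up P = some out) (e' : List ℕ)
    (he' : e'.Sublist (outsideOf G.ns P))
    (hlen : e'.length ≤ (W - P.length) / 2)
    (hred : (gaussPiv (P.map M)).red (frhs Mp P ^^^ xorIdx M e') = 0) (x : ℕ)
    (hx : x ∈ (gaussPiv (P.map M)).solutions (P.map M) (frhs Mp P ^^^ xorIdx M e')) :
    mkWord G P e'.reverse x ∈ out := by
  unfold fiberPT at hout
  simp only at hout
  set Pv := gaussPiv (P.map M)
  have hx2 : x ∈ Pv.solutions (P.map M)
      (frhs Mp P ^^^ xorIdx (fun oc : ℕ × ℕ × ℕ => oc.2.1) (e'.map fun o => (o, M o, Pv.red (M o)))) := by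
    rw [xorIdx_map]; exact hx
  have hrv : Pv.red (frhs Mp P) ^^^ xorIdx (fun oc : ℕ × ℕ × ℕ => oc.2.2)
      (e'.map fun o => (o, M o, Pv.red (M o))) = 0 := by
    rw [xorIdx_map, ← hred, red_xor, red_xorIdx]; rfl
  have hid : List.map (Prod.fst ∘ fun o => (o, M o, Pv.red (M o))) e' = e' := by
    rw [show (Prod.fst ∘ fun o => (o, M o, Pv.red (M o))) = id from rfl, List.map_id]
  have hsub : (e'.map fun o => (o, M o, Pv.red (M o))).Sublist ((outsideOf G.ns P).map fun o => (o, M o, Pv.red (M o))) :=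
    he'.map _
  split at hout
  · -- small budget: the plain scan
    split at hout
    · simp only [Option.some.injEq] at hout
      subst hout
      rw [List.mem_map]
      refine ⟨(e'.reverse ++ [], x), ?_, by simp⟩
      have := scan_complete _ _ _ ((W - P.length) / 2) (frhs Mp P) _ [] _ hsub
        (by rw [List.length_map]; exact hlen) hrv x hx2
      rw [List.map_map, hid] at this
      exact this
    · simp at hout
  · split at hout
    · rename_i hchk
      simp only [Option.some.injEq] at hout
      subst hout
      unfold fiberPTchk at hchk
      rw [Bool.and_eq_true, Bool.and_eq_true] at hchk
      obtain ⟨⟨_, hk1⟩, hk2⟩ := hchk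
      set s := (W - P.length) / 2 with hs
      set Ot := (outsideOf G.ns P).map fun o => (o, M o, Pv.red (M o)) with hOt
      set pr := up && decide (2 ≤ s) with hpr
      set T := nodeTabOf G.r b pr Ot
      rw [List.mem_map]
      refine ⟨(e'.reverse ++ [], x), ?_, by simp⟩
      have hsub : (e'.map fun o => (o, M o, Pv.red (M o))).Sublist Ot := he'.map _
      have hx2 : x ∈ Pv.solutions (P.map M)
          (frhs Mp P ^^^ xorIdx (fun oc : ℕ × ℕ × ℕ => oc.2.1) (e'.map fun o => (o, M o, Pv.red (M o)))) := by
        rw [xorIdx_map]; exact hx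
      have hrv : Pv.red (frhs Mp P) ^^^ xorIdx (fun oc : ℕ × ℕ × ℕ => oc.2.2)
          (e'.map fun o => (o, M o, Pv.red (M o))) = 0 := by
        rw [xorIdx_map, ← hred, red_xor, red_xorIdx]; rfl
      have hid : List.map (Prod.fst ∘ fun o => (o, M o, Pv.red (M o))) e' = e' := by
        rw [show (Prod.fst ∘ fun o => (o, M o, Pv.red (M o))) = id from rfl, List.map_id]
      -- case s = 0: only the empty choice, served by the leaf (no table facts needed)
      by_cases hs0 : s = 0
      · have he0 : e' = [] := List.eq_nil_of_length_eq_zero (by omega)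
        subst he0
        simp only [xorIdx_nil, Nat.xor_zero, List.map_nil] at hx2 hrv ⊢
        rw [hs0]
        have hl : ([], x) ∈ leafPT Pv (P.map M) (frhs Mp P) (Pv.red (frhs Mp P)) [] := by
          rw [hrv]; simp only [leafPT, beq_self_eq_true, if_true, List.mem_map]; exact ⟨x, hx2, rfl⟩
        cases hO : Ot with
        | nil => simpa [scanPT] using hl
        | cons _ _ => simpa [scanPT] using hl
      -- otherwise the index facts hold, and the pair facts when the budget is ≥ 2
      have hk1' : tabOK1 T G.r b Ot 0 = true := by
        rw [Bool.or_eq_true] at hk1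
        rcases hk1 with h | h
        · simp [hs0] at h
        · exact h
      have HT1 : IdxFacts T G.r b Ot := fun j oc h => by
        have := tabOK1_sound T G.r b Ot 0 hk1' j oc h
        simp only [Nat.zero_add] at this
        exact this
      have HT2 : pr = true → PairFacts T b Ot := by
        intro h2s j1 j2 a c hlt h1 h2
        rw [Bool.or_eq_true] at hk2
        rcases hk2 with h | h
        · simp [h2s] at h
        · have := tabOK2_sound T b Ot 0 h j1 j2 a c hlt h1 h2; simpa using this
      have := scanPT_complete Pv (P.map M) T G.r b Ot HT1 pr HT2 Ot s (frhs Mp P) _ [] 0 (by simp) _ hsub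
        (by rw [List.length_map]; exact hlen) hrv x hx2
      rw [List.map_map, hid] at this
      exact this
    · simp at hout

end Summit.Ventures.QEC.Census.Fold

namespace Summit.Ventures.QEC.Census.Fold

open Summit.Ventures.QEC.Census

namespace Geo

variable {G : Geo}
/-- **FIBRE COMPLETENESS (table-assisted enumerator).**  Under the index facts `G.OK`: if the enumerator (with correct column
tables `M = fcol`, `Mp = pcol` on the small window) succeeds on the support of `t`, every big kernel word
of weight `≤ W` whose fold is `t` is (the word of) one of its outputs. -/
theorem fiberPT_complete (hG : G.OK) {C : TCode} {M Mp : ℕ → ℕ} (hM : ∀ j, j < G.ns → M j = fcol G C j)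
    (hMp : ∀ j, j < G.ns → Mp j = pcol G C j) {W t : ℕ} (ht : t < 2 ^ G.ns) {out : List (List ℕ)}
    {md : ℕ} {up : Bool} (hout : fiberPT G M Mp W md up (bitsOf G.ns 0 t) = some out) {u : ℕ} (hu : u < 2 ^ G.n) (hker : C.ker G.n u)
    (hwt : popc G.n u ≤ W) (hfold : G.foldW u = t) :
    ∃ S ∈ out, maskOf S = u ∧ (∀ J ∈ S, J < G.n) ∧ S.length = popc G.n u := by
  -- names
  set P := bitsOf G.ns 0 t with hPdef
  set a := G.aPart u with ha
  set b := G.bPart u with hb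
  have hab : a ^^^ b = t := by rw [ha, hb, ← foldW_eq_parts, hfold]
  have hbt : b = a ^^^ t := by rw [← hab, ← Nat.xor_assoc, Nat.xor_self, Nat.zero_xor]
  have hPlt : ∀ j ∈ P, j < G.ns := fun j hj => lt_of_mem_bitsOf hj
  have hPmask : maskOf P = t := maskOf_bitsOf_zero _ _ ht
  have hPlen : P.length = popc G.ns t := length_bitsOf _ _ _
  have hPM : P.map M = P.map (fcol G C) := List.map_congr_left fun j hj => hM j (hPlt j hj)
  set O := outsideOf G.ns P with hOdef
  set e := O.filter fun j => (a &&& b).testBit j with hedef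
  set x := restrictTo P 0 a with hxdef
  have hPnodup : P.Nodup := hPdef ▸ nodup_bitsOf _ _ _
  have hOmem : ∀ j, j ∈ O ↔ j < G.ns ∧ j ∉ P := fun j => by
    rw [hOdef, outsideOf, mem_bitsOf_zero_iff, Nat.testBit_xor, Nat.testBit_two_pow_sub_one,
      testBit_maskOf_nodup P hPnodup]
    by_cases hj : j < G.ns <;> by_cases hp : j ∈ P <;> simp [hj, hp]
  have hOlt : ∀ j ∈ O, j < G.ns := fun j hj => ((hOmem j).1 hj).1
  have helt : ∀ j ∈ e, j < G.ns := fun j hj => hOlt j (List.mem_of_mem_filter hj)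
  have heM : xorIdx M e = xorIdx (fcol G C) e := xorIdx_congr fun j hj => hM j (helt j hj)
  have hfr : frhs Mp P = lin (fun j => C.col (G.partner (G.emb j))) G.ns 0 t := by
    rw [frhs, xorIdx_congr (h := pcol G C) (fun j hj => hMp j (hPlt j hj)), xorIdx_eq_lin _ _ _ hPlt, hPmask]; rfl
  -- mask of e = a ∧ b
  have hOnodup : O.Nodup := hOdef ▸ nodup_bitsOf _ _ _
  have hemask : maskOf e = a &&& b := by
    rw [hedef, maskOf_filter_testBit]
    apply Nat.eq_of_testBit_eq; intro i
    rw [Nat.testBit_and, testBit_maskOf_nodup O hOnodup]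
    rcases hbit : (a &&& b).testBit i with _ | _
    · simp
    · simp only [Bool.true_and, decide_eq_true_eq, hOmem]
      rw [Nat.testBit_and, Bool.and_eq_true] at hbit
      refine ⟨?_, ?_⟩
      · by_contra hi
        rw [not_lt] at hi
        have := Nat.testBit_lt_two_pow (lt_of_lt_of_le (aPart_lt hG u) (Nat.pow_le_pow_right (by norm_num) hi))
        rw [← ha] at this; rw [this] at hbit; exact Bool.false_ne_true hbit.1
      · have hti : t.testBit i = false := by
          rw [← hab, Nat.testBit_xor, hbit.1, hbit.2]; rfl
        rw [hPdef, mem_bitsOf_zero_iff, hti]; simp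
  -- budget
  have hlen : e.length ≤ (W - P.length) / 2 := by
    have hcard : e.length = popc G.ns (a &&& b) := by
      rw [popc_eq_card, hedef, ← List.toFinset_card_of_nodup (hOnodup.filter _), List.toFinset_filter]
      congr 1
      ext i
      simp only [Finset.mem_filter, Finset.mem_range, List.mem_toFinset, hOmem]
      constructor
      · rintro ⟨⟨hi, -⟩, hb'⟩; exact ⟨hi, hb'⟩
      · rintro ⟨hi, hb'⟩
        refine ⟨⟨hi, ?_⟩, hb'⟩
        rw [hPdef, mem_bitsOf_zero_iff, ← hab, Nat.testBit_xor]
        rw [Nat.testBit_and, Bool.and_eq_true] at hb'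
        rw [hb'.1, hb'.2]; simp
    have hw : popc G.n u = popc G.ns t + 2 * popc G.ns (a &&& b) := by
      rw [popc_eq_parts hG hu, ← ha, ← hb, ← popc_xor_add, hab]
    rw [hcard, hPlen]; omega
  -- the linear system
  have hsys : selXor (P.map M) x = frhs Mp P ^^^ xorIdx M e := by
    have h0 : lin C.col G.n 0 u = 0 := hker
    rw [recon hG hu, lin_xor, lin_col_embW hG, lin_col_parW hG, ← ha, ← hb, hbt, lin_xor] at h0
    have hf : lin (fun j => C.col (G.emb j)) G.ns 0 a ^^^ lin (fun j => C.col (G.partner (G.emb j))) G.ns 0 a =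
        lin (fcol G C) G.ns 0 a := by rw [← lin_xor_fun]; rfl
    have ha2 : lin (fcol G C) G.ns 0 a = xorIdx M e ^^^ selXor (P.map M) x := by
      conv_lhs => rw [← and_xor_self_decomp a b, hab, lin_xor]
      rw [heM, hPM, xorIdx_eq_lin _ _ _ helt, hemask, selXor_map_eq_lin _ _ _ hPlt, hxdef, selP_restrictTo, hPmask]
    rw [← Nat.xor_assoc, hf, ← hfr, ha2] at h0
    exact xor_eq_of_xor_xor_eq_zero h0
  -- the solver lists x, and the leaf is not pruned
  have hpiv := pivOKcore_of_pivOK (pivOK_of_fiberPT G M Mp W md up P hout)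
  have hxlt : x < 2 ^ (P.map M).length := by
    rw [List.length_map, hxdef]; have := restrictTo_lt P 0 a; rwa [Nat.zero_add] at this
  have hxsol : x ∈ (gaussPiv (P.map M)).solutions (P.map M) (frhs Mp P ^^^ xorIdx M e) := by
    have := solutions_complete hpiv x
    rwa [Nat.mod_eq_of_lt hxlt, hsys] at this
  have hred : (gaussPiv (P.map M)).red (frhs Mp P ^^^ xorIdx M e) = 0 := by
    rw [← hsys]; exact red_selXor (pivOK_of_fiberPT G M Mp W md up P hout) x
  -- hence the word is produced
  have herev : ∀ j ∈ e.reverse, j < G.ns := fun j hj => helt j (List.mem_reverse.1 hj)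
  refine ⟨mkWord G P e.reverse x, mem_fiberPT_of_solution G M Mp W md up P hout e (List.filter_sublist) hlen hred x hxsol, ?_,
    mkWord_bound hG P e.reverse hPlt herev x, ?_⟩
  · have h1 : (a &&& b) ^^^ (a &&& t) = a := by rw [← hab]; exact and_xor_self_decomp a b
    have h2 : (a &&& b) ^^^ (t ^^^ (a &&& t)) = b := by
      rw [Nat.xor_left_comm, h1, hbt, Nat.xor_comm]
    rw [maskOf_mkWord P e.reverse hPlt herev, maskOf_reverse, hemask, hxdef, selP_restrictTo, hPmask, h1, h2]
    exact (recon hG hu).symm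
  · rw [length_mkWord, List.length_reverse]
    have hcard : e.length = popc G.ns (a &&& b) := by
      rw [popc_eq_card, hedef, ← List.toFinset_card_of_nodup (hOnodup.filter _), List.toFinset_filter]
      congr 1
      ext i
      simp only [Finset.mem_filter, Finset.mem_range, List.mem_toFinset, hOmem]
      constructor
      · rintro ⟨⟨hi, -⟩, hb'⟩; exact ⟨hi, hb'⟩
      · rintro ⟨hi, hb'⟩
        refine ⟨⟨hi, ?_⟩, hb'⟩
        rw [hPdef, mem_bitsOf_zero_iff, ← hab, Nat.testBit_xor]
        rw [Nat.testBit_and, Bool.and_eq_true] at hb'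
        rw [hb'.1, hb'.2]; simp
    have hw : popc G.n u = popc G.ns t + 2 * popc G.ns (a &&& b) := by
      rw [popc_eq_parts hG hu, ← ha, ← hb, ← popc_xor_add, hab]
    rw [hw, hcard, hPlen]; ring
/-- The enumeration branch of the node check: every fibre word satisfies the per-output conclusion. -/
theorem goodFib_of_allPT (hG : G.OK) {C : TCode} {M Mp : ℕ → ℕ} (hM : ∀ j, j < G.ns → M j = fcol G C j)
    (hMp : ∀ j, j < G.ns → Mp j = pcol G C j) {W : ℕ} {t : ℕ} (ht : t < 2 ^ G.ns) {out : List (List ℕ)}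
    {b : ℕ} {up : Bool} (hout : fiberPT G M Mp W b up (bitsOf G.ns 0 t) = some out) {kk : List ℕ → Bool} {K : ℕ → Prop}
    (hkk : ∀ S', (∀ J ∈ S', J < G.n) → S'.length = popc G.n (maskOf S') → kk S' = true → K (maskOf S'))
    (hall : out.all kk = true) : GoodFib G C W K t := by
  intro u hu hker hwt hfold
  obtain ⟨S', hS', hmask, hbnd, hlen⟩ := fiberPT_complete hG hM hMp ht hout hu hker hwt hfold
  rw [List.all_eq_true] at hall
  have := hkk S' hbnd (by rw [hmask]; exact hlen) (hall S' hS')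
  rwa [hmask] at this

end Geo
/-- **NODE CHECK SOUNDNESS (table-assisted)**: a passing node check of the small word with support `S` gives the fibre
property `GoodFib … Q (maskOf S)` — the EMPTY branch by the certified reduction, the enumeration branch
by `fiber_complete`, the pair guard by `goodFib_of_guarded`. -/
theorem nodeCheckPT_sound {G : Geo} (hS : G.Shape) (hG : G.OK) {C : TCode} (hC : C.l = G.l ∧ C.m = G.m)
    (heq : C.ColEquiv G.gen.1 G.gen.2) (hcol : ∀ J, J < C.n → C.col J < 2 ^ (C.l * C.m))
    {M Mp Mr : ℕ → ℕ} (hM : ∀ j, j < G.ns → M j = fcol G C j) (hMp : ∀ j, j < G.ns → Mp j = pcol G C j)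
    {Pall : Piv} (hPall : pivOK ((List.range G.ns).map M) Pall = true) (hMr : ∀ j, j < G.ns → Mr j = Pall.red (Mp j))
    {W b : ℕ} {up : Bool} {k : List ℕ → Bool} {Q : ℕ → Prop} (hQ : ∀ u, Q (transW G.l G.m G.gen.1 G.gen.2 u) → Q u)
    (hk : ∀ S', (∀ J ∈ S', J < G.n) → S'.length = popc G.n (maskOf S') → k S' = true → Q (maskOf S'))
    {S : List ℕ} (hSb : ∀ j ∈ S, j < G.ns) (h : nodeCheckPT G M Mp Mr W b up k S = true) :
    GoodFib G C W Q (maskOf S) := by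
  have hSlt : maskOf S < 2 ^ G.ns := maskOf_lt _ _ hSb
  rw [nodeCheckPT, Bool.or_eq_true] at h
  rcases h with h | h
  · -- certified-empty branch: impossible, a fibre word would give a solution of the full system
    intro u hu hker hwt hfold
    exfalso
    simp only [Bool.not_eq_true', beq_eq_false_iff_ne, ne_eq] at h
    have hsol := Geo.fcol_aPart_eq_frhs hG hMp hSb hu hker hfold
    have heqs : selXor ((List.range G.ns).map M) (G.aPart u) = lin (fcol G C) G.ns 0 (G.aPart u) := by
      rw [selXor, List.length_map, List.length_range]
      exact lin_congr (i0 := 0) (fun j hj => by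
        rw [Nat.zero_add, List.getD_eq_getElem?_getD, List.getElem?_map, List.getElem?_range hj, Option.map_some,
          Option.getD_some, hM j hj]) _
    have hred := red_selXor hPall (G.aPart u)
    rw [heqs, hsol, frhs, red_xorIdx] at hred
    rw [xorIdx_congr (h := fun j => Pall.red (Mp j)) (fun j hj => hMr j (hSb j hj))] at h
    exact h hred
  · simp only at h
    split at h
    · simp at h
    · rename_i out hout
      have hout' : fiberPT G M Mp W b up (bitsOf G.ns 0 (maskOf S)) = some out := hout
      cases hP : bitsOf G.ns 0 (maskOf S) with
      | nil =>
        rw [hP] at h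
        exact Geo.goodFib_of_allPT hG hM hMp hSlt hout' (kk := guardP G [] k) (K := Q)
          (fun S' hS' hl h' => hk S' hS' hl (by simpa [guardP] using h')) h
      | cons p₀ P' =>
        rw [hP] at h
        have hK := Geo.goodFib_of_allPT hG hM hMp hSlt hout' (kk := guardP G (p₀ :: P') k)
          (K := fun u => u.testBit (G.emb p₀) = false ∨ Q u) (Geo.guardP_cons_sound (p₀ := p₀) (P' := P') hk) h
        have hp₀ : p₀ ∈ bitsOf G.ns 0 (maskOf S) := by rw [hP]; exact List.mem_cons_self ..
        rw [mem_bitsOf_zero_iff] at hp₀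
        exact Geo.goodFib_of_guarded hG hS hC heq hcol hSlt hp₀.1 hp₀.2 hQ hK
/-- All slices of a node check make the node check. -/
theorem nodeCheckPT_of_nodeCheckModPT {G : Geo} {M Mp Mr : ℕ → ℕ} {W b : ℕ} {up : Bool} {k : List ℕ → Bool} {S : List ℕ} {q : ℕ}
    (hq : 0 < q) (h : ∀ res, res < q → nodeCheckModPT G M Mp Mr W b up k S q res = true) :
    nodeCheckPT G M Mp Mr W b up k S = true := by
  by_cases hf : (xorIdx Mr S == 0) = true
  · unfold nodeCheckPT
    simp only [hf, Bool.not_true, Bool.false_or]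
    split
    · rename_i hnone
      have := h 0 hq
      unfold nodeCheckModPT at this
      simp [hf, hnone] at this
    · rename_i out hout
      refine all_of_allMod hq out 0 fun res hres => ?_
      have := h res hres
      unfold nodeCheckModPT at this
      simp only [hf, Bool.not_true, Bool.false_or, hout] at this
      exact this
  · unfold nodeCheckPT
    simp only [Bool.not_eq_true] at hf
    simp [hf]

end Summit.Ventures.QEC.Census.Fold
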